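import Literature.Computability.MetaComplexity.ConstructiveSeparations
import Literature.Computability.Complexity.BPClosureProofs
import Literature.Computability.Complexity.ProbabilisticClassesProofs
import Literature.Computability.Complexity.BPPSubsetAlmostP
import HarnessLib

/-!
# Constructive separations: the `NP` instance of Thm. 1.2 (unconditional part and reductions)

Topic `Literature/Computability/MetaComplexity`; companion of `ConstructiveSeparations.lean`
(L. Chen, C. Jin, R. Santhanam, R. Williams, *Constructive separations and their consequences*,
FOCS 2021 = arXiv:2203.14379v5 [ChenEtAl2022]) for its named fact
`constructiveSeparation_of_not_subset_BPP_NP` (Thm. 1.2 for `(𝒞, 𝒟) = (BPP, NP)`). Everything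
here is PROVED and no named fact is introduced; the fact itself is NOT discharged (see the status
note). The `(BPP, PSPACE)` instance is discharged in `ConstructiveSeparationsProofs.lean`.

## Contents

* `mem_BPP_of_eqOn_le` — `BPP` is invariant under finite variations: a language agreeing with
  some `L'' ∈ BPP` on all inputs of length `≥ n₀` is in `BPP` (patch the `P`-witness language of
  `L''` on the short first components). This is the remark of [ChenEtAl2022, §1, footnote 1]
  ("If the family of counterexamples was finite, we could hard-code them into the algorithm").
* `frequently_exists_errs_of_not_mem_BPP`, `frequently_exists_errs_of_isComplete_NP` — the
  non-constructive half of Thm. 1.2 for `(BPP, NP)`: if `NP ⊄ BPP`, `L` is `NP`-complete and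
  `L'' ∈ BPP`, then for infinitely many `n` some `n`-bit string lies in `L ∆ L''` (the refuted
  algorithm errs at infinitely many lengths; no paddability needed).
* `HasPConstructiveSeparation.anti`, `HasBPPConstructiveSeparation.anti` — a constructive
  separation from a class is one from every subclass (Def. 1.1 quantifies over the algorithms of
  the class).
* `constructiveSeparation_of_not_subset_BPP_NP_of_SigmaP` — the vendored `NP` instance is the
  case `k = 1` of the vendored `Σₖᵖ` instance (`Σ₁ᵖ = NP`, `SigmaP_one_holds`); in print the whole
  family `{P, ZPP, BPP} × {Σₖ P}_{k ≥ 1}` is one corollary of the theorem "Adaptation of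
  [GutfreundST07]" of §5.2.
* `constructiveSeparation_of_not_subset_BPP_NP_of_BPP_subset_P` — under `BPP ⊆ P` the
  `(BPP, NP)` instance follows from the `(P, NP)` instance
  `pConstructiveSeparation_of_not_NP_subset_P` (a `P`-refuter is a coin-free `BPP`-refuter,
  `hasBPPConstructiveSeparation_of_hasPConstructiveSeparation`).

## Status note (this tree) on `constructiveSeparation_of_not_subset_BPP_NP`

The printed proof of Thm. 1.2 for `𝒟 = Σₖᵖ` is the proof sketch of the theorem "Adaptation of
[GutfreundST07]" (§5.2), which treats `𝒞 = P` and delegates `𝒞 ∈ {BPP, ZPP}` to "the same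
proof as the `𝒞 = PTIME` case, and … the amplification argument described at the end of the
proof of [Thm. 5.4]" — fix a good coin string `r` of the amplified algorithm `A'` and run the
`P`-case construction on the deterministic `A'(·, r)` — the resulting constant-size list-refuter
being converted into a refuter by Lemma 5.3, whose randomized clause is stated for
PSEUDO-DETERMINISTIC list-refuters. For `k = 1` the questions the construction puts to the
refuted algorithm ("does there exist a string `x` of length `|x| = m ≤ m'` such that condition
(2) is satisfied", condition (2) evaluating the refuted algorithm) are `NP`-questions — hence
Karp-reducible to the `NP`-complete `L` — only once the coins `r` are written into the instance;
the strings of the list then depend on `r`, the list-refuter is not pseudo-deterministic, and the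
pigeonhole of Lemma 5.3 over list positions yields a fixed position succeeding with probability
`≥ (1 - o(1))/c` (`c` the list size), not the `2/3` of Def. 1.1, whose footnote warns that this
constant is not known to be amplifiable. By contrast, for `𝒟 ⊇ BPP` the error language
`G_A = {(1ⁿ, x) : ∃ y ⊒ x, |y| = n, L(y) ≠ A(y)}` of §5.1 can be formed from the bounded-gap
algorithm itself, the oracle queries stay coin-free and the coin run follows a canonical path on
good coins — this is how `ConstructiveSeparationsProofs.lean` discharges the `PSPACE` instance;
for `𝒟 = NP` that language is not available (`y ∉ L''` resp. `y ∉ L` inside the `∃`). The source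
cited for the `NP ⊄ BPP` case, Gutfreund–Shaltiel–Ta-Shma, comput. complex. 16 (2007)
[GutfreundShaltielTashma2007], proves the randomized statement in list form only (Lemma 4.1: at
most three formulae, one of them erroneous with probability `1 - 1/n`; Thm. 1.5(ii)) and records
in Remark 4.2 / Open Question 6.1 that raising the sampled error above `1/3` is open. Accordingly
this file proves what is unconditional (counterexamples exist at infinitely many lengths) and the
derivation of the `(BPP, NP)` instance from `BPP ⊆ P` and the `(P, NP)` instance.
-/

namespace Literature.Computability.MetaComplexity

open _root_.Computability Complexity Filter

/-! ### `BPP` is invariant under finite variations -/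

/-- **`BPP` is closed under finite variations.** If `L` agrees with some `L'' ∈ BPP` on every
input of length at least `n₀`, then `L ∈ BPP`: keep the `P`-witness language `L'` of `L''` on
pairs `⟨x, y⟩` with `|x| ≥ n₀` and replace it by the (finite, hence `P`) table of `L` on the
shorter `x`; on long `x` the acceptance events are those of `L''`, on short `x` every coin
string is correct. [cite: ChenEtAl2022, §1 (footnote 1)] -/
theorem mem_BPP_of_eqOn_le {L L'' : Language Bool} (hL'' : L'' ∈ BPP) (n₀ : ℕ)
    (h : ∀ x : List Bool, n₀ ≤ x.length → (x ∈ L ↔ x ∈ L'')) : L ∈ BPP := by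
  obtain ⟨L', hL', p, hp⟩ := hL''
  -- the patched witness language: `L'` on long first components, the table of `L` on short ones
  let Lw : Language Bool :=
    {w | (n₀ ≤ (boolUnpair w).1.length ∧ w ∈ L') ∨ ((boolUnpair w).1 ∈ L ∧ (boolUnpair w).1.length < n₀)}
  have hLw : Lw ∈ Classes.P := by
    have he : Lw = (((fun w => (boolUnpair w).1) ⁻¹' {x : List Bool | n₀ ≤ x.length}) ⊓ L') ⊔
        ((fun w => (boolUnpair w).1) ⁻¹' {x : List Bool | x ∈ L ∧ x.length < n₀}) :=
      Set.ext fun _ => Iff.rfl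
    rw [he]
    exact union_mem_P
      (inter_mem_P (preimage_mem_P (setOf_le_length_mem_P n₀) boolUnpairFst_mem_FP) hL')
      (preimage_mem_P (shortPart_mem_P L n₀) boolUnpairFst_mem_FP)
  have key : ∀ x y : List Bool, boolPair x y ∈ Lw ↔
      (n₀ ≤ x.length ∧ boolPair x y ∈ L') ∨ (x ∈ L ∧ x.length < n₀) := fun x y => by
    change (n₀ ≤ (boolUnpair (boolPair x y)).1.length ∧ boolPair x y ∈ L') ∨
        ((boolUnpair (boolPair x y)).1 ∈ L ∧ (boolUnpair (boolPair x y)).1.length < n₀) ↔ _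
    rw [boolUnpair_boolPair]
  refine ⟨Lw, hLw, p, fun x => ?_⟩
  by_cases hx : n₀ ≤ x.length
  · have hset : {y : List Bool | boolPair x y ∈ Lw ↔ x ∈ L} =
        {y : List Bool | boolPair x y ∈ L' ↔ x ∈ L''} := by
      ext y
      simp only [Set.mem_setOf_eq, key, hx, true_and, not_lt.2 hx, and_false, or_false, h x hx]
    rw [hset]
    exact hp x
  · have hset : {y : List Bool | boolPair x y ∈ Lw ↔ x ∈ L} = Set.univ := by
      refine Set.eq_univ_of_forall fun y => ?_
      simp only [Set.mem_setOf_eq, key, hx, false_and, false_or, lt_of_not_ge hx, and_true]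
    rw [hset, uniformProb_univ]
    norm_num

/-! ### Counterexamples exist at infinitely many lengths -/

/-- **The refuted algorithm errs at infinitely many lengths.** If `L ∉ BPP` and `L'' ∈ BPP`, then
for infinitely many `n` some `n`-bit string lies in the symmetric difference `L ∆ L''`
(otherwise `L` would be a finite variation of `L''`, `mem_BPP_of_eqOn_le`). This is the
non-constructive content of a `BPP`-constructive separation of `L` from `BPP`.
[cite: ChenEtAl2022, §1 (footnote 1) and Def. 1.1] -/
theorem frequently_exists_errs_of_not_mem_BPP {L L'' : Language Bool} (hL : L ∉ BPP)
    (hL'' : L'' ∈ BPP) :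
    ∃ᶠ n in atTop, ∃ x : List Bool, x.length = n ∧ (x ∈ L ↔ x ∉ L'') := by
  by_contra hcon
  rw [Filter.not_frequently, Filter.eventually_atTop] at hcon
  obtain ⟨n₀, hn₀⟩ := hcon
  refine hL (mem_BPP_of_eqOn_le hL'' n₀ fun x hx => ?_)
  have hx' := hn₀ x.length hx
  push Not at hx'
  have hxx := hx' x rfl
  tauto

/-- **Thm. 1.2 `(BPP, NP)`, existence half.** If `NP ⊄ BPP`, `L` is `NP`-complete and
`L'' ∈ BPP`, then `L''` errs about `L` on some `n`-bit input for infinitely many `n` (`L ∉ BPP`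
by closure of `BPP` under Karp reductions, `NP_subset_BPP_of_isNPHard_of_mem_BPP`, then
`frequently_exists_errs_of_not_mem_BPP`). What Thm. 1.2 adds is that such inputs can be
PRODUCED in probabilistic polynomial time. [cite: ChenEtAl2022, Def. 1.1 and Thm. 1.2] -/
theorem frequently_exists_errs_of_isComplete_NP
    (hNP : ¬ Nondeterministic.NP ⊆ BPP) {L L'' : Language Bool}
    (hL : IsComplete Nondeterministic.NP L) (hL'' : L'' ∈ BPP) :
    ∃ᶠ n in atTop, ∃ x : List Bool, x.length = n ∧ (x ∈ L ↔ x ∉ L'') :=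
  frequently_exists_errs_of_not_mem_BPP
    (fun hLB => hNP (NP_subset_BPP_of_isNPHard_of_mem_BPP hL.isHard hLB)) hL''

/-- `NP ⊄ BPP` implies `NP ⊄ P` (`P ⊆ BPP`, `P_subset_BPP_holds`). [cite: ChenEtAl2022, Thm. 1.2] -/
theorem not_NP_subset_P_of_not_NP_subset_BPP (hNP : ¬ Nondeterministic.NP ⊆ BPP) :
    ¬ Nondeterministic.NP ⊆ Classes.P :=
  fun hP => hNP (hP.trans P_subset_BPP_holds)

/-! ### Monotonicity in the refuted class -/

/-- A `P`-constructive separation of `L` from `D` is one from every subclass `C ⊆ D` (Def. 1.1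
asks for a refuter against every algorithm of the class). [cite: ChenEtAl2022, Def. 1.1] -/
theorem HasPConstructiveSeparation.anti {L : Language Bool} {C D : Set (Language Bool)}
    (hCD : C ⊆ D) (h : HasPConstructiveSeparation L D) : HasPConstructiveSeparation L C :=
  fun L'' hL'' => h L'' (hCD hL'')

/-- A `BPP`-constructive separation of `L` from `D` is one from every subclass `C ⊆ D`.
[cite: ChenEtAl2022, Def. 1.1] -/
theorem HasBPPConstructiveSeparation.anti {L : Language Bool} {C D : Set (Language Bool)}
    (hCD : C ⊆ D) (h : HasBPPConstructiveSeparation L D) : HasBPPConstructiveSeparation L C :=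
  fun L'' hL'' => h L'' (hCD hL'')

/-! ### Relations between the vendored instances of Thm. 1.2 -/

/-- **The `NP` instance is the case `k = 1` of the `Σₖᵖ` instance** (`Σ₁ᵖ = NP`,
`SigmaP_one_holds`): the paper proves the whole family `{P, ZPP, BPP} × {Σₖ P}_{k ≥ 1}` by one
corollary of §5.2. [cite: ChenEtAl2022, Thm. 1.2 and §5.2 (Corollary for {P, ZPP, BPP} × {Σₖ P})] -/
theorem constructiveSeparation_of_not_subset_BPP_NP_of_SigmaP
    (h : constructiveSeparation_of_not_subset_BPP_SigmaP) :
    constructiveSeparation_of_not_subset_BPP_NP := by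
  have h1 : constructiveSeparation_of_not_subset_BPP (SigmaP 1) := h 1 le_rfl
  have e : SigmaP 1 = Nondeterministic.NP := SigmaP_one_holds
  rw [e] at h1
  exact h1

/-- **Under `BPP ⊆ P` the `(BPP, NP)` instance follows from the `(P, NP)` instance.** From
`NP ⊄ BPP` get `NP ⊄ P` (`P ⊆ BPP`); the `(P, NP)` instance gives against every `L'' ∈ P ⊇ BPP`
a `P`-refuter, which is a coin-free `BPP`-refuter
(`hasBPPConstructiveSeparation_of_hasPConstructiveSeparation`). In particular the `(BPP, NP)`
instance holds in any world with `P = BPP`. [cite: ChenEtAl2022, Def. 1.1 and Thm. 1.2] -/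
theorem constructiveSeparation_of_not_subset_BPP_NP_of_BPP_subset_P (hBPP : BPP ⊆ Classes.P)
    (h : pConstructiveSeparation_of_not_NP_subset_P) :
    constructiveSeparation_of_not_subset_BPP_NP := by
  intro hNP L hL hpad
  have hsep : HasPConstructiveSeparation L Classes.P :=
    h (not_NP_subset_P_of_not_NP_subset_BPP hNP) L hL hpad
  exact hasBPPConstructiveSeparation_of_hasPConstructiveSeparation (hsep.anti hBPP)

end Literature.Computability.MetaComplexity
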